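import Summits.CriticalPhenomena.PercolationContinuityZ3.Theorems.Transplant.SkelNegBParamsLF
import Summits.CriticalPhenomena.PercolationContinuityZ3.Theorems.Transplant.SkelNegParamsFineMultA
import Summits.CriticalPhenomena.PercolationContinuityZ3.Theorems.Transplant.SkelNegParamsFineA
import HarnessLib

/-!
# N1 params, chain of record `NegB`, part LF-A — THE (ζ′) RE-VERSION'S ROOT: the coarse-lattice constant **`NegB.Aof κ := 20·K = 800·Kq`**, the cells of record
# **`NegB.fcellsA κ Φ t p D g f := ⟨K, m^A − 1⟩`** over the multipliers `m^A_i := mOfA_i (Aof κ) K n_L h_L ℓ_L v_L = ⌊modulus/L̂_i⌋` ('Kq dropped'), and the fine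
# window map **`NegB.fineA κ Φ t p D g f φ′ := NegPrm.fineA φ′ t (Aof κ) fcellsA n_L h_L ℓ_L v_L`** with every scheme-geometry hypothesis discharged by name
# (`hψ0`/`hlip`/`hws`/kit drift/φ-extent/FINE STEPS/`hcol`) — the twin of part LF (p28xxxx, `A = 800`) at `A := Aof κ` (stmt-g16 2026-08-22; NEG-SCOPE §B.19 (ζ′),
# FEASIBILITY §ζ′, p3-g11 01:45:32Z/01:52:01Z (3), lead g7 01:38:43Z/01:54:34Z; plan of record lane INBOX 03:0xZ)
WHY `A := 20·K`: the fine resolution is `c_i = 20K·s_i` (hard-wired in `NegPrm.fine(A)`), so `c_i = A·s_i` and one lattice period `u` reads as exactly `s_i` fine cells —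
the long stride is `s∥` cells ('κ₀ := s∥'), the kit square `r = K·s = K` strides = `40·Kq` strides; cells per period (`= ⌊mod/L̂_i⌋ − 1`) and every cell-unit quantity
are as today; stride COUNTS scale `×Kq` (absorbed downstream: `NrOfA`, `exA`, `fxA`, `gxA`, `qB3·A`). The slot layer (`ML/nL/hL/ℓL/vL/vβL/EqNumL/SMn`, part L/LF §1) is
REUSED unchanged; nothing of record is edited.
builds on p205010 (kernel theorem, internal audit signed; external expert review pending) — nothing in this file uses p205010; NOTHING is claimed about the node
`SamePDropOfSkeletonNeg₁` (OPEN; additive closure `…_of_choiceFnNOWA` adopted on accept; this chain feeds its tuple `negChoiceAllOTA`).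
Lane `prim-bschramm-*`, seat `prim-bschramm-stmt` (gen 16); helper file (`--supports stmt-CriticalPhenomena-4575 --as helper`); ledger HOME/prim-bschramm-stmt/NEG-PARAMS.md.
* §0 **`Aof`**, `Aof_eq_K`, `Aof_eq_Kq`, `le_Aof` (`800 ≤ A`), `Aof_pos`; §0b the budgets **`LfA K₀ := 2000·Kq`**, **`nmaxCA := 824·Kq`**, **`nFA := LfA`** (`nmaxCA_le_LfA`, `nFA_le_LfA`);
* §1 `m0A/m1A`, `mA_eq` (`= ⌊modulus/L̂_i⌋`), `fm0A/fm1A/fmNatA`, **`fcellsA`**, `fcellsA_K`, `R'_le_fmA_at`, `one_le_fmA_at`, `fcellsA_s_at`, **`c_eq_A_mul_s`** (`20K·s_i = A·s_i`),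
  `cL_le_D_fcellsA_at`, **`room_fcellsA_at`**;
* §2 **`fineA φ′`**, `fineA_eq`, `fineA_base_at`, `lip_fineA_at`, `weakSteps_fineA_at`, `fineA_drift_at`, `φ_extent_fineA_at` (`|Δφ′_i| ≤ 2(n_L+ℓ_L+3|h_L|+1)(r+1)`);
* §3 **`NrepA`**, `cA_pos`, **`exists_fineA_eq_at`**, **`hcol_fineA_at`**, `hcol_fineA_of_sched`.
[cite: KozmaNitzan2024, §4 pp. 25–26 (two-unit cells), p. 26 ((29): columns), Lemma 10 Step IV] [cite: MartineauTassion2017, §4.3 (the cell lattice)]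
-/

noncomputable section

open scoped Classical

namespace Summit.CriticalPhenomena.PercolationContinuityZ3.Theorems.Transplant

namespace PlanarSkeletonNeg

namespace NegB

open Literature.Probability.Percolation Literature.Probability.LatticeModels SimpleGraph
open Literature.Barriers.CriticalPhenomena (graphBall)
open SkelConc (Consts)
open Neg

/-! ## §0 The coarse-lattice constant of the (ζ′) chain -/

/-- **THE COARSE-LATTICE CONSTANT OF RECORD** `A := 20·K` (`= 800·Kq`; `K = Kcell K₀ = 40·Kq`). IRREDUCIBLE (use `Aof_eq_K`/`Aof_eq_Kq`): unfolding `K = 40·(Kof K₀/40 + 1)`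
under `whnf` (e.g. inside `positivity`) is a heartbeat sink. [this work] -/
irreducible_def Aof (κ : Consts) : ℤ := 20 * (Neg.K κ : ℤ)

/-- `A = 20·K`. [folklore] -/
theorem Aof_eq_K (κ : Consts) : Aof κ = 20 * (Neg.K κ : ℤ) := Aof_def κ

/-- `A = 800·Kq`. [folklore] -/
theorem Aof_eq_Kq (κ : Consts) : Aof κ = 800 * (Neg.Kq κ : ℤ) := by rw [Aof_eq_K, Neg.K_eq]; push_cast; ring

/-- `800 ≤ A` (`Kq ≥ 1`). [folklore] -/
theorem le_Aof (κ : Consts) : 800 ≤ Aof κ := by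
  have h : (1 : ℤ) ≤ Neg.Kq κ := by exact_mod_cast Neg.one_le_Kq κ
  rw [Aof_eq_Kq]; linarith

/-- `0 < A` and `A ≠ 0`. [folklore] -/
theorem Aof_pos (κ : Consts) : 0 < Aof κ ∧ Aof κ ≠ 0 := by
  have := le_Aof κ
  exact ⟨by linarith, by intro h; rw [h] at this; linarith⟩

/-! ## §0b The length budgets of the NOWL closure (p3-g11 02:53:30Z / 03:03:22Z) -/

/-- **THE INNER-CHAIN LENGTH BUDGET OF RECORD** `LfA K₀ := 2000·Kq = 2000·(Kof K₀/40 + 1)` — the `Lf` the node₁ file hands to `samePDropOfSkeletonNeg₁_of_choiceFnNOWL`; every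
(R)/(F)/(C) inner chain of the (ζ′) tuple is shorter (`×Kq` counts ≤ 1200·Kq + 2`). [this work] -/
def LfA (K₀ : ℕ) : ℕ := 2000 * Skelφ.NegPrm.Kq K₀

/-- `LfA κ.K₀ = 2000·Kq`. [folklore] -/
theorem LfA_eq (κ : Consts) : LfA κ.K₀ = 2000 * Neg.Kq κ := rfl

/-- **THE (C) CORRIDOR LENGTH OF RECORD** `nmaxCA K₀ := 824·Kq` (p5 lineage's count; the (C) target is `∃ nmax := nmaxCA K₀, nmax ≤ LfA K₀ ∧ ReachOblRHN … (κ.δr 0)`). [this work] -/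
def nmaxCA (K₀ : ℕ) : ℕ := 824 * Skelφ.NegPrm.Kq K₀

/-- `nmaxCA κ.K₀ = 824·Kq`. [folklore] -/
theorem nmaxCA_eq (κ : Consts) : nmaxCA κ.K₀ = 824 * Neg.Kq κ := rfl

/-- `nmaxCA ≤ LfA`. [folklore] -/
theorem nmaxCA_le_LfA (K₀ : ℕ) : nmaxCA K₀ ≤ LfA K₀ := by unfold nmaxCA LfA; omega

/-- **THE (F) FACE-CHAIN LENGTH OF RECORD** `nFA := LfA` (hp-8's keystone `nF`; `0 + 1 + Nr + 1 + N₃ ≤ nFA` is served next to the absorbers `NrOfA ≤ 1000·Kq`, `N₃ ≤ 200·Kq`). [this work] -/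
def nFA (K₀ : ℕ) : ℕ := LfA K₀

/-- `nFA ≤ LfA` and `nFA κ.K₀ = 2000·Kq`. [folklore] -/
theorem nFA_le_LfA (K₀ : ℕ) : nFA K₀ ≤ LfA K₀ ∧ nFA K₀ = LfA K₀ := ⟨le_rfl, rfl⟩

/-- `2000 ≤ LfA`, `824 ≤ nmaxCA` (`Kq ≥ 1`). [folklore] -/
theorem LfA_ge (K₀ : ℕ) : 2000 ≤ LfA K₀ ∧ 824 ≤ nmaxCA K₀ := by
  have := Skelφ.NegPrm.one_le_Kq K₀; unfold LfA nmaxCA; constructor <;> omega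

section LFLevel

variable (κ : Consts) {V : Type} [DecidableEq V] [Countable V] {G : SimpleGraph V} [G.LocallyFinite] (Φ : PlanarSkeletonNeg G) (t : V)
  (p : unitInterval) (D : Skelφ.StepI.DataN V) (g f : ℕ)

/-! ## §1 The cells of record at `A := Aof κ` -/

/-- The maximal fine multiplier of axis `0` at `A`: `m₀^A := mOfA₀ A K n_L h_L ℓ_L v_L`. [this work] -/
def m0A : ℤ := Skelφ.NegPrm.mOfA₀ (Aof κ) (Neg.K κ) (nL κ Φ t p D g f) (hL κ Φ t p D g f) (ℓL κ Φ t p D g f) (vL κ Φ t p D g f)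

/-- The maximal fine multiplier of axis `1` at `A`: `m₁^A := mOfA₁ A K n_L h_L ℓ_L v_L`. [this work] -/
def m1A : ℤ := Skelφ.NegPrm.mOfA₁ (Aof κ) (Neg.K κ) (nL κ Φ t p D g f) (hL κ Φ t p D g f) (ℓL κ Φ t p D g f) (vL κ Φ t p D g f)

/-- **'Kq dropped from the divisor'**: `m₀^A = ⌊modulus/L̂₀⌋`, `m₁^A = ⌊modulus/L̂₁⌋`. [this work] -/
theorem mA_eq : m0A κ Φ t p D g f =
      TwoAxis.Para.modulus (nL κ Φ t p D g f) (hL κ Φ t p D g f) (vL κ Φ t p D g f) (vβL κ Φ t p D g f) /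
        Skelφ.NegPrm.L0hat (nL κ Φ t p D g f) (hL κ Φ t p D g f) (ℓL κ Φ t p D g f) (vL κ Φ t p D g f) ∧
    m1A κ Φ t p D g f =
      TwoAxis.Para.modulus (nL κ Φ t p D g f) (hL κ Φ t p D g f) (vL κ Φ t p D g f) (vβL κ Φ t p D g f) /
        Skelφ.NegPrm.L1hat (nL κ Φ t p D g f) (hL κ Φ t p D g f) :=
  Skelφ.NegPrm.mOfA_eq_of_twentyK (Neg.forty_le_K κ).2.2 (Aof_eq_K κ) _ _ _ _

/-- The fine multiplier of record, axis `0`: `m₀^A − 1`. [this work] -/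
def fm0A : ℤ := m0A κ Φ t p D g f - 1

/-- The fine multiplier of record, axis `1`: `m₁^A − 1`. [this work] -/
def fm1A : ℤ := m1A κ Φ t p D g f - 1

/-- The stub increments of record `max 1 (m^A_i − 1).toNat` (`= m^A_i − 1` under the long clause). [this work] -/
def fmNatA : Fin 2 → ℕ := ![max 1 (fm0A κ Φ t p D g f).toNat, max 1 (fm1A κ Φ t p D g f).toNat]

/-- **THE TWO-UNIT CELLS OF RECORD OF THE (ζ′) CHAIN** `⟨K, m^A − 1⟩` (one notch below maximal: rounding room). [cite: KozmaNitzan2024, §4 pp. 25–26] -/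
def fcellsA : PCells2 := ⟨Neg.K κ, fmNatA κ Φ t p D g f, (Neg.forty_le_K κ).2.1, fun i => by unfold fmNatA; fin_cases i <;> exact le_max_left _ _⟩

/-- The cells' `K` is `Neg.K κ` (`κ.K₀ ≤ K`) and `r_i = K·s_i`. [folklore] -/
theorem fcellsA_K : (fcellsA κ Φ t p D g f).K = Neg.K κ ∧ κ.K₀ ≤ (fcellsA κ Φ t p D g f).K ∧
    ∀ i, (fcellsA κ Φ t p D g f).r i = Neg.K κ * (fcellsA κ Φ t p D g f).s i :=
  ⟨rfl, Neg.K₀_le_K κ, fun _ => rfl⟩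

/-- **`R′ ≤ m^A_i − 1`** at the ledger's values (`le_mOfA_both` at `s := R′ + 1`, floor `4K(R′+1)+2 ≤ M_L`, `800 ≤ A`). [this work] -/
theorem R'_le_fmA_at (hN : EqNumL κ Φ t p D g f) : (R' κ Φ t p D : ℤ) ≤ fm0A κ Φ t p D g f ∧ (R' κ Φ t p D : ℤ) ≤ fm1A κ Φ t p D g f := by
  obtain ⟨hn, hℓ, hv, hlay⟩ := hN
  have hM := floor_R'succ κ Φ t p D g
  have h := Skelφ.NegPrm.le_mOfA_both (le_Aof κ) (s := (R' κ Φ t p D : ℤ) + 1) (Neg.forty_le_K κ).2.2 (by positivity) hM hn hℓ hlay hv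
  unfold fm0A fm1A m0A m1A
  constructor
  · linarith [h.1]
  · linarith [h.2]

/-- `1 ≤ m^A₀ − 1` and `1 ≤ m^A₁ − 1`. [folklore] -/
theorem one_le_fmA_at (hN : EqNumL κ Φ t p D g f) : 1 ≤ fm0A κ Φ t p D g f ∧ 1 ≤ fm1A κ Φ t p D g f := by
  have h := R'_le_fmA_at κ Φ t p D g f hN
  have hR : (1 : ℤ) ≤ R' κ Φ t p D := by exact_mod_cast (one_le_R' κ Φ t p D).1
  exact ⟨hR.trans h.1, hR.trans h.2⟩

/-- **The stub increments ARE `m^A_i − 1`** under the long clause. [folklore] -/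
theorem fcellsA_s_at (hN : EqNumL κ Φ t p D g f) :
    (((fcellsA κ Φ t p D g f).s 0 : ℕ) : ℤ) = fm0A κ Φ t p D g f ∧ (((fcellsA κ Φ t p D g f).s 1 : ℕ) : ℤ) = fm1A κ Φ t p D g f := by
  obtain ⟨h0, h1⟩ := one_le_fmA_at κ Φ t p D g f hN
  have e0 : (fcellsA κ Φ t p D g f).s 0 = max 1 (fm0A κ Φ t p D g f).toNat := rfl
  have e1 : (fcellsA κ Φ t p D g f).s 1 = max 1 (fm1A κ Φ t p D g f).toNat := rfl
  rw [e0, e1]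
  constructor
  · rw [max_eq_right (by omega), Int.toNat_of_nonneg (by omega)]
  · rw [max_eq_right (by omega), Int.toNat_of_nonneg (by omega)]

/-- **THE (ζ′) UNIT IDENTITY**: the fine resolutions are `c_i = 20K·s_i = A·s_i` — one lattice period reads as `s_i` fine cells. [this work] -/
theorem c_eq_A_mul_s (i : Fin 2) : 20 * ((fcellsA κ Φ t p D g f).K : ℤ) * (((fcellsA κ Φ t p D g f).s i : ℕ) : ℤ) = Aof κ * (((fcellsA κ Φ t p D g f).s i : ℕ) : ℤ) := by
  rw [(fcellsA_K κ Φ t p D g f).1, Aof_eq_K]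

/-- **The resolution inequalities `c_i·L_i ≤ D_A` for the cells of record** (`c_i = 20K·(m^A_i − 1) ≤ 20K·m^A_i`). [folklore] -/
theorem cL_le_D_fcellsA_at (hN : EqNumL κ Φ t p D g f) :
    20 * ((fcellsA κ Φ t p D g f).K : ℤ) * (((fcellsA κ Φ t p D g f).s 0 : ℕ) : ℤ) * (|Aof κ| * (|vβL κ Φ t p D g f| + |vL κ Φ t p D g f|)) ≤
        Skelφ.NegPrm.DofA (Aof κ) (nL κ Φ t p D g f) (hL κ Φ t p D g f) (ℓL κ Φ t p D g f) (vL κ Φ t p D g f) ∧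
      20 * ((fcellsA κ Φ t p D g f).K : ℤ) * (((fcellsA κ Φ t p D g f).s 1 : ℕ) : ℤ) * (|Aof κ| * (|(nL κ Φ t p D g f : ℤ)| + |hL κ Φ t p D g f|)) ≤
        Skelφ.NegPrm.DofA (Aof κ) (nL κ Φ t p D g f) (hL κ Φ t p D g f) (ℓL κ Φ t p D g f) (vL κ Φ t p D g f) := by
  obtain ⟨hn1, hℓ1⟩ := one_le_of_eqNumL κ Φ t p D g f hN
  obtain ⟨e0, e1⟩ := fcellsA_s_at κ Φ t p D g f hN
  have hA := (Aof_pos κ).1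
  have hK : (0 : ℤ) ≤ (Neg.K κ : ℤ) := by positivity
  -- the `c_i·L_i ≤ D_A` of the MAXIMAL multipliers, restated with the chain's names (all `rfl`)
  have c0 : 20 * (Neg.K κ : ℤ) * m0A κ Φ t p D g f * (|Aof κ| * (|vβL κ Φ t p D g f| + |vL κ Φ t p D g f|)) ≤
      Skelφ.NegPrm.DofA (Aof κ) (nL κ Φ t p D g f) (hL κ Φ t p D g f) (ℓL κ Φ t p D g f) (vL κ Φ t p D g f) :=
    Skelφ.NegPrm.cL_le_DA₀ hA (K := Neg.K κ) hn1 hℓ1 (hL κ Φ t p D g f) (vL κ Φ t p D g f)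
  have c1 : 20 * (Neg.K κ : ℤ) * m1A κ Φ t p D g f * (|Aof κ| * (|(nL κ Φ t p D g f : ℤ)| + |hL κ Φ t p D g f|)) ≤
      Skelφ.NegPrm.DofA (Aof κ) (nL κ Φ t p D g f) (hL κ Φ t p D g f) (ℓL κ Φ t p D g f) (vL κ Φ t p D g f) :=
    Skelφ.NegPrm.cL_le_DA₁ hA (K := Neg.K κ) hn1 hℓ1 (hL κ Φ t p D g f) (vL κ Φ t p D g f)
  rw [(fcellsA_K κ Φ t p D g f).1, e0, e1]
  have X0 : (0 : ℤ) ≤ |Aof κ| * (|vβL κ Φ t p D g f| + |vL κ Φ t p D g f|) :=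
    mul_nonneg (abs_nonneg _) (add_nonneg (abs_nonneg _) (abs_nonneg _))
  have X1 : (0 : ℤ) ≤ |Aof κ| * (|(nL κ Φ t p D g f : ℤ)| + |hL κ Φ t p D g f|) :=
    mul_nonneg (abs_nonneg _) (add_nonneg (abs_nonneg _) (abs_nonneg _))
  have f0 : fm0A κ Φ t p D g f = m0A κ Φ t p D g f - 1 := rfl
  have f1 : fm1A κ Φ t p D g f = m1A κ Φ t p D g f - 1 := rfl
  rw [f0, f1]
  constructor
  · nlinarith [c0, mul_nonneg hK X0]
  · nlinarith [c1, mul_nonneg hK X1]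

/-- **THE ROUNDING ROOM `c_i·L_i + 2 ≤ D_A` of the cells of record** (one notch: `20K(m^A_i − 1)·A·L̂_i + 20K·A·L̂_i ≤ D_A`, `L̂_i ≥ 1`, `K ≥ 1`, `A ≥ 800`) — the hypothesis of
`fine_rep` / `exists_mem_graphBall_fineSkel_eq` / `hcol_fineSkel`. [this work] -/
theorem room_fcellsA_at (hN : EqNumL κ Φ t p D g f) :
    20 * ((fcellsA κ Φ t p D g f).K : ℤ) * (((fcellsA κ Φ t p D g f).s 0 : ℕ) : ℤ) * (|Aof κ| * (|vβL κ Φ t p D g f| + |vL κ Φ t p D g f|)) + 2 ≤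
        Skelφ.NegPrm.DofA (Aof κ) (nL κ Φ t p D g f) (hL κ Φ t p D g f) (ℓL κ Φ t p D g f) (vL κ Φ t p D g f) ∧
      20 * ((fcellsA κ Φ t p D g f).K : ℤ) * (((fcellsA κ Φ t p D g f).s 1 : ℕ) : ℤ) * (|Aof κ| * (|(nL κ Φ t p D g f : ℤ)| + |hL κ Φ t p D g f|)) + 2 ≤
        Skelφ.NegPrm.DofA (Aof κ) (nL κ Φ t p D g f) (hL κ Φ t p D g f) (ℓL κ Φ t p D g f) (vL κ Φ t p D g f) := by
  obtain ⟨hn1, hℓ1⟩ := one_le_of_eqNumL κ Φ t p D g f hN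
  obtain ⟨e0, e1⟩ := fcellsA_s_at κ Φ t p D g f hN
  have hK : (1 : ℤ) ≤ (Neg.K κ : ℤ) := by exact_mod_cast (Neg.forty_le_K κ).2.2
  have hA := (Aof_pos κ).1
  have hA8 := le_Aof κ
  have c0 : 20 * (Neg.K κ : ℤ) * m0A κ Φ t p D g f * (|Aof κ| * (|vβL κ Φ t p D g f| + |vL κ Φ t p D g f|)) ≤
      Skelφ.NegPrm.DofA (Aof κ) (nL κ Φ t p D g f) (hL κ Φ t p D g f) (ℓL κ Φ t p D g f) (vL κ Φ t p D g f) :=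
    Skelφ.NegPrm.cL_le_DA₀ hA (K := Neg.K κ) hn1 hℓ1 (hL κ Φ t p D g f) (vL κ Φ t p D g f)
  have c1 : 20 * (Neg.K κ : ℤ) * m1A κ Φ t p D g f * (|Aof κ| * (|(nL κ Φ t p D g f : ℤ)| + |hL κ Φ t p D g f|)) ≤
      Skelφ.NegPrm.DofA (Aof κ) (nL κ Φ t p D g f) (hL κ Φ t p D g f) (ℓL κ Φ t p D g f) (vL κ Φ t p D g f) :=
    Skelφ.NegPrm.cL_le_DA₁ hA (K := Neg.K κ) hn1 hℓ1 (hL κ Φ t p D g f) (vL κ Φ t p D g f)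
  rw [(fcellsA_K κ Φ t p D g f).1, e0, e1]
  have eA : |Aof κ| = Aof κ := abs_of_pos hA
  have hL0 : (1 : ℤ) ≤ |vβL κ Φ t p D g f| + |vL κ Φ t p D g f| := one_le_L0 hn1 hℓ1 _ _
  have hL1 : (1 : ℤ) ≤ |(nL κ Φ t p D g f : ℤ)| + |hL κ Φ t p D g f| := by
    rw [abs_of_nonneg (by positivity : (0 : ℤ) ≤ (nL κ Φ t p D g f : ℤ))]
    have : (1 : ℤ) ≤ nL κ Φ t p D g f := by exact_mod_cast hn1
    linarith [abs_nonneg (hL κ Φ t p D g f)]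
  rw [eA] at c0 c1 ⊢
  have f0 : fm0A κ Φ t p D g f = m0A κ Φ t p D g f - 1 := rfl
  have f1 : fm1A κ Φ t p D g f = m1A κ Φ t p D g f - 1 := rfl
  rw [f0, f1]
  -- `20K(m − 1)·A·L + 2 ≤ 20K·m·A·L ≤ D_A` since `20K·A·L ≥ 20·800·1 ≥ 2`
  have hAL0 : 2 ≤ 20 * (Neg.K κ : ℤ) * (Aof κ * (|vβL κ Φ t p D g f| + |vL κ Φ t p D g f|)) := by
    have h1 : (1 : ℤ) * (800 * 1) ≤ (Neg.K κ : ℤ) * (Aof κ * (|vβL κ Φ t p D g f| + |vL κ Φ t p D g f|)) :=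
      mul_le_mul hK (mul_le_mul hA8 hL0 (by norm_num) hA.le) (by norm_num) (by linarith)
    linarith
  have hAL1 : 2 ≤ 20 * (Neg.K κ : ℤ) * (Aof κ * (|(nL κ Φ t p D g f : ℤ)| + |hL κ Φ t p D g f|)) := by
    have h1 : (1 : ℤ) * (800 * 1) ≤ (Neg.K κ : ℤ) * (Aof κ * (|(nL κ Φ t p D g f : ℤ)| + |hL κ Φ t p D g f|)) :=
      mul_le_mul hK (mul_le_mul hA8 hL1 (by norm_num) hA.le) (by norm_num) (by linarith)
    linarith
  constructor
  · nlinarith [c0, hAL0]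
  · nlinarith [c1, hAL1]

/-! ## §2 The fine window map of the (ζ′) chain (map slot `φ′`) -/

/-- **THE FINE WINDOW MAP OF THE (ζ′) CHAIN AT THE LEDGER'S VALUES**, planar map a slot: `fineA φ′ := NegPrm.fineA φ′ t A fcellsA n_L h_L ℓ_L v_L`. [this work] -/
def fineA (φ' : V → Site 2) : V → Site 2 :=
  Skelφ.NegPrm.fineA φ' t (Aof κ) (fcellsA κ Φ t p D g f) (nL κ Φ t p D g f) (hL κ Φ t p D g f) (ℓL κ Φ t p D g f) (vL κ Φ t p D g f)

/-- `fineA` unfolded. [folklore] -/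
theorem fineA_eq (φ' : V → Site 2) :
    fineA κ Φ t p D g f φ' = Skelφ.NegPrm.fineA φ' t (Aof κ) (fcellsA κ Φ t p D g f) (nL κ Φ t p D g f) (hL κ Φ t p D g f) (ℓL κ Φ t p D g f) (vL κ Φ t p D g f) :=
  rfl

/-- **BASE POINT** (`hψ0` of `sepGeomSG₂` at `w₀ = t`): `fineA φ′ t = 0`. [folklore] -/
theorem fineA_base_at (φ' : V → Site 2) (hN : EqNumL κ Φ t p D g f) : fineA κ Φ t p D g f φ' t = 0 := by
  obtain ⟨hn1, hℓ1⟩ := one_le_of_eqNumL κ Φ t p D g f hN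
  exact Skelφ.NegPrm.fineA_base φ' t (Aof_pos κ).2 _ hn1 hℓ1 _ _

/-- **`hlip`**: the fine map is 1-Lipschitz for a 1-Lipschitz `φ′`. [cite: MartineauTassion2017, §4.3] -/
theorem lip_fineA_at {φ' : V → Site 2} (hlip : Skelφ.Lip G φ') (hN : EqNumL κ Φ t p D g f) : Skelφ.Lip G (fineA κ Φ t p D g f φ') := by
  obtain ⟨hn1, hℓ1⟩ := one_le_of_eqNumL κ Φ t p D g f hN
  obtain ⟨c0, c1⟩ := cL_le_D_fcellsA_at κ Φ t p D g f hN
  exact Skelφ.NegPrm.lip_fineA hlip t (Aof_pos κ).2 _ hn1 hℓ1 c0 c1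

/-- **`hws`**: the fine map has weak steps for a unit-step `φ′`. [this work] -/
theorem weakSteps_fineA_at {φ' : V → Site 2} (hstep : Skelφ.Steps G φ') (hN : EqNumL κ Φ t p D g f) : Skelφ.WeakSteps G (fineA κ Φ t p D g f φ') := by
  obtain ⟨hn1, hℓ1⟩ := one_le_of_eqNumL κ Φ t p D g f hN
  exact Skelφ.NegPrm.weakSteps_fineA hstep t (Aof_pos κ).2 _ hn1 hℓ1 _ _

/-- **KIT DRIFT READS AS AT MOST `R′` FINE UNITS** (inside one stub increment `m^A_i − 1 ≥ R′`). [cite: KozmaNitzan2024, §4 Lemma 10 Step IV] -/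
theorem fineA_drift_at (hN : EqNumL κ Φ t p D g f) {φ' : V → Site 2} {w w' : V} (h0 : |φ' w 0 - φ' w' 0| ≤ (R' κ Φ t p D : ℤ))
    (h1 : |φ' w 1 - φ' w' 1| ≤ (R' κ Φ t p D : ℤ)) (i : Fin 2) : |fineA κ Φ t p D g f φ' w i - fineA κ Φ t p D g f φ' w' i| ≤ (R' κ Φ t p D : ℤ) := by
  obtain ⟨hn1, hℓ1⟩ := one_le_of_eqNumL κ Φ t p D g f hN
  obtain ⟨c0, c1⟩ := cL_le_D_fcellsA_at κ Φ t p D g f hN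
  exact Skelφ.NegPrm.fineA_drift_le t (Aof_pos κ).2 _ hn1 hℓ1 c0 c1 (by positivity) h0 h1 i

/-- **A FINE BOX IS A φ′-BOX**: `|Δ fineA|_∞ ≤ r ⇒ 10K·|Δφ′_i| ≤ A·(n_L + ℓ_L + 3|h_L| + 1)·(r + 1)`, i.e. (with `A = 20K`) `|Δφ′_i| ≤ 2·(n_L + ℓ_L + 3|h_L| + 1)·(r + 1)`.
[cite: KozmaNitzan2024, §4 Lemma 12 (p. 24)] -/
theorem φ_extent_fineA_at (hN : EqNumL κ Φ t p D g f) {φ' : V → Site 2} {w w' : V} {r : ℤ} (hr : 0 ≤ r)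
    (hρ : ∀ i, |fineA κ Φ t p D g f φ' w i - fineA κ Φ t p D g f φ' w' i| ≤ r) (i : Fin 2) :
    10 * (Neg.K κ : ℤ) * |φ' w i - φ' w' i| ≤ Aof κ * ((nL κ Φ t p D g f : ℤ) + ℓL κ Φ t p D g f + 3 * |hL κ Φ t p D g f| + 1) * (r + 1) ∧
      |φ' w i - φ' w' i| ≤ 2 * ((nL κ Φ t p D g f : ℤ) + ℓL κ Φ t p D g f + 3 * |hL κ Φ t p D g f| + 1) * (r + 1) := by
  obtain ⟨hn1, hℓ1⟩ := one_le_of_eqNumL κ Φ t p D g f hN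
  obtain ⟨-, -, hv, -⟩ := hN
  have h := Skelφ.NegPrm.φ_extent_of_fineA_extent t (Aof_pos κ).1 _ hn1 hℓ1 _ hv hr hρ i
  have hKf : ((fcellsA κ Φ t p D g f).K : ℤ) = (Neg.K κ : ℤ) := by rw [(fcellsA_K κ Φ t p D g f).1]
  rw [hKf] at h
  refine ⟨h, ?_⟩
  rw [Aof_eq_K] at h
  have hK : (0 : ℤ) < (Neg.K κ : ℤ) := by exact_mod_cast (Neg.forty_le_K κ).2.2
  have e : 20 * (Neg.K κ : ℤ) * (((nL κ Φ t p D g f : ℤ) + ℓL κ Φ t p D g f + 3 * |hL κ Φ t p D g f| + 1) * (r + 1)) * 1 =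
      10 * (Neg.K κ : ℤ) * (2 * ((nL κ Φ t p D g f : ℤ) + ℓL κ Φ t p D g f + 3 * |hL κ Φ t p D g f| + 1) * (r + 1)) := by ring
  have h' : 10 * (Neg.K κ : ℤ) * |φ' w i - φ' w' i| ≤ 10 * (Neg.K κ : ℤ) * (2 * ((nL κ Φ t p D g f : ℤ) + ℓL κ Φ t p D g f + 3 * |hL κ Φ t p D g f| + 1) * (r + 1)) := by
    linarith
  exact le_of_mul_le_mul_left h' (by linarith)

/-! ## §3 The column radius, FINE STEPS, and the column point `hcol` -/

/-- **The column radius of record** `NrepA z := ‖rep₂ z‖₁` at lattice constant `A` and the resolutions of `fcellsA`. [this work] -/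
def NrepA (z : Site 2) : ℕ :=
  (TwoAxis.Para.rep₂ (Aof κ) (nL κ Φ t p D g f) (hL κ Φ t p D g f) (vL κ Φ t p D g f) (vβL κ Φ t p D g f)
      (20 * ((fcellsA κ Φ t p D g f).K : ℤ) * (((fcellsA κ Φ t p D g f).s 0 : ℕ) : ℤ)) (20 * ((fcellsA κ Φ t p D g f).K : ℤ) * (((fcellsA κ Φ t p D g f).s 1 : ℕ) : ℤ)) z 0).natAbs +
    (TwoAxis.Para.rep₂ (Aof κ) (nL κ Φ t p D g f) (hL κ Φ t p D g f) (vL κ Φ t p D g f) (vβL κ Φ t p D g f)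
      (20 * ((fcellsA κ Φ t p D g f).K : ℤ) * (((fcellsA κ Φ t p D g f).s 0 : ℕ) : ℤ)) (20 * ((fcellsA κ Φ t p D g f).K : ℤ) * (((fcellsA κ Φ t p D g f).s 1 : ℕ) : ℤ)) z 1).natAbs

/-- The resolutions of the cells of record are positive. [folklore] -/
theorem cA_pos (i : Fin 2) : (0 : ℤ) < 20 * ((fcellsA κ Φ t p D g f).K : ℤ) * (((fcellsA κ Φ t p D g f).s i : ℕ) : ℤ) := by
  have hK : (1 : ℤ) ≤ ((fcellsA κ Φ t p D g f).K : ℤ) := by rw [(fcellsA_K κ Φ t p D g f).1]; exact_mod_cast (Neg.forty_le_K κ).2.2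
  have hs : (1 : ℤ) ≤ (((fcellsA κ Φ t p D g f).s i : ℕ) : ℤ) := by exact_mod_cast (fcellsA κ Φ t p D g f).hs i
  nlinarith

/-- **FINE STEPS**: from `t`, for every fine position `z`, a vertex `g` with `fineA φ′ g = z` within graph distance `NrepA z` (unit steps of `φ′`, the rounding room of
`fcellsA`). [cite: KozmaNitzan2024, §4 Lemma 10 Step IV (pp. 20–21)] -/
theorem exists_fineA_eq_at {φ' : V → Site 2} (hstep : Skelφ.Steps G φ') (hN : EqNumL κ Φ t p D g f) (z : Site 2) :
    ∃ w, w ∈ graphBall G t (NrepA κ Φ t p D g f z) ∧ fineA κ Φ t p D g f φ' w = z := by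
  obtain ⟨hn1, hℓ1⟩ := one_le_of_eqNumL κ Φ t p D g f hN
  obtain ⟨r0, r1⟩ := room_fcellsA_at κ Φ t p D g f hN
  have hD := Skelφ.NegPrm.DofA_pos (Aof_pos κ).2 hn1 hℓ1 (hL κ Φ t p D g f) (vL κ Φ t p D g f)
  obtain ⟨w, hw, hwz⟩ := Skelφ.exists_mem_graphBall_fineSkel_eq (A := Aof κ) (n := (nL κ Φ t p D g f : ℤ)) (h := hL κ Φ t p D g f)
    (vα := vL κ Φ t p D g f) (vβ := vβL κ Φ t p D g f) hstep t (cA_pos κ Φ t p D g f 0) (cA_pos κ Φ t p D g f 1) hD r0 r1 z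
  exact ⟨w, hw, hwz⟩

/-- **THE COLUMN POINT `hcol` of `sepGeomSG₂`** for the fine map of the (ζ′) chain: for every cube `Q x` of `fcellsA` and every radius `R ≥ NrepA (cen x) + 1`, a vertex of
fine position exactly `cen x` inside the window span `VWin (Q x) R`. [cite: KozmaNitzan2024, §4 p. 26 ((29): columns)] -/
theorem hcol_fineA_at {φ' : V → Site 2} (hlip : Skelφ.Lip G φ') (hstep : Skelφ.Steps G φ') (hN : EqNumL κ Φ t p D g f) (x : Site 2) {R : ℕ}
    (hR : NrepA κ Φ t p D g f ((fcellsA κ Φ t p D g f).cen x) + 1 ≤ R) :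
    ∃ y ∈ Skelφ.VWin G (fineA κ Φ t p D g f φ') t ((fcellsA κ Φ t p D g f).Q x) R, fineA κ Φ t p D g f φ' y = (fcellsA κ Φ t p D g f).cen x := by
  obtain ⟨hn1, hℓ1⟩ := one_le_of_eqNumL κ Φ t p D g f hN
  obtain ⟨r0, r1⟩ := room_fcellsA_at κ Φ t p D g f hN
  have hD := Skelφ.NegPrm.DofA_pos (Aof_pos κ).2 hn1 hℓ1 (hL κ Φ t p D g f) (vL κ Φ t p D g f)
  exact Skelφ.hcol_fineSkel (A := Aof κ) (n := (nL κ Φ t p D g f : ℤ)) (h := hL κ Φ t p D g f) (vα := vL κ Φ t p D g f) (vβ := vβL κ Φ t p D g f) hlip hstep t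
    (cA_pos κ Φ t p D g f 0) (cA_pos κ Φ t p D g f 1) hD r0 r1 (fcellsA κ Φ t p D g f) x hR

/-- **`hcol` in the shape `sepGeomSG₂` consumes**, from a schedule whose cube radii dominate the column radius. [folklore] -/
theorem hcol_fineA_of_sched {φ' : V → Site 2} (hlip : Skelφ.Lip G φ') (hstep : Skelφ.Steps G φ') (hN : EqNumL κ Φ t p D g f) {Λ : BoxProdZ2.ConcRadiiG}
    (hcolQ : ∀ a x, NrepA κ Φ t p D g f ((fcellsA κ Φ t p D g f).cen x) + 1 ≤ Λ.rQ a x) :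
    ∀ a x, ∃ y ∈ Skelφ.VWin G (fineA κ Φ t p D g f φ') t ((fcellsA κ Φ t p D g f).Q x) (Λ.rQ a x), fineA κ Φ t p D g f φ' y = (fcellsA κ Φ t p D g f).cen x :=
  fun a x => hcol_fineA_at κ Φ t p D g f hlip hstep hN x (hcolQ a x)

end LFLevel

end NegB

end PlanarSkeletonNeg

end Summit.CriticalPhenomena.PercolationContinuityZ3.Theorems.Transplant

end
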